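import Literature.NumberTheory.IwasawaTheory.FukudaElementaryLayerNakayama
import HarnessLib

/-!
# The CYCLIC GENERATOR of a finite `ℤ[φ]`-module with `#(M/ν₁M) ≤ p` (`M = ℤ[φ]·x₀`, `p·x₀ ∈ ν₁M`), and the filtration count
# `#(M/(T^mM + P)) ≤ (#(M/(TM + P)))^m`

Topic `NumberTheory/IwasawaTheory` (namespace `Literature.NumberTheory.IwasawaTheory.FukudaElementary`).  THEOREM-ONLY file (no definition,
no named fact, no instance, no `sorry`), written by the prover seat `bsd-line-att-p3` g47 (cell `bsd-f1-sign2`, route `AlignedTransportAtTwo`;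
`--supports` stmt-BirchSwinnertonDyer-22298, closes nothing; BSD is not advanced by this file).  Second of three algebra bricks behind the door
`ClassGroupPRankLeOfNotElementaryLayer` (sequel of `FukudaElementaryLayerNakayama`).

* §3 `eq_of_le_of_card_quotient_le` (subgroups `S ⊆ S'` with `#(M/S) ≤ #(M/S')` coincide), `map_top_geom_sum_le` (`ν₁M ⊆ pM + (φ−1)M`), and
  ★ **`exists_generator`**: `M` a finite abelian `p`-group, `φ^{p^t} = 1`, `#(M/ν₁M) ≤ p` (`ν₁ = ∑_{i<p} φ^i`) ⟹ **`M = ℤ[φ]·x₀` for some `x₀` with `p·x₀ ∈ ν₁M`**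
  (`ν₁M ⊆ 𝔪M = pM + TM` has index `≤ p`, so `M/𝔪M` is cyclic of order `≤ p`; Nakayama lifts a generator; `ν₁M = 𝔪M` by counting unless `M = 0`).
  In the Fukuda package over a base with `p ∤ h_K` this is «`e_1 ≤ 1 ⟹ X` cyclic over `Λ`» at finite level (Washington §13.3: `A_1 = X/ν₁X`).
* §4 the filtration count `card_quotient_range_pow_sup_le_pow`: **`#(M/(T^mM + P)) ≤ #(M/(TM + P))^m`** for a `T`-stable subgroup `P` (each graded piece
  `(T^kM + P)/(T^{k+1}M + P)` is a quotient of `M/(TM + P)`; re-proved here because the tree's copy in `ClassicalMuVanishesBoundedRankAlgebra` is private and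
  specialised to `P = pM`).

References: [Washington1997] L. Washington, *Introduction to Cyclotomic Fields*, 2nd ed., §13.2 Lemma 13.16, §13.3 Lemma 13.15 and Prop. 13.23 (proof);
[Fukuda1994] T. Fukuda, *Remarks on ℤ_p-extensions of number fields*, Proc. Japan Acad. 70 A (1994), Thm. 1 and its proof, p. 264.
-/

set_option autoImplicit false

noncomputable section

open Polynomial Finset

namespace Literature.NumberTheory.IwasawaTheory.FukudaElementary

section Module

variable {M : Type*} [AddCommGroup M] {p : ℕ}

/-! ## §3 The cyclic generator -/

/-- Two subgroups `S ⊆ S'` of a finite abelian group with `#(M/S) ≤ #(M/S')` are equal (the counting step of Washington's proof).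
[cite: Washington1997, §13.3 Prop. 13.23 (proof)] -/
theorem eq_of_le_of_card_quotient_le [Finite M] {S S' : Submodule ℤ M} (h : S ≤ S')
    (hc : Nat.card (M ⧸ S) ≤ Nat.card (M ⧸ S')) : S = S' := by
  haveI : Finite (M ⧸ S) := Finite.of_surjective _ (Submodule.Quotient.mk_surjective _)
  haveI : Finite (M ⧸ S') := Finite.of_surjective _ (Submodule.Quotient.mk_surjective _)
  have h1 := Submodule.card_eq_card_quotient_mul_card S
  have h2 := Submodule.card_eq_card_quotient_mul_card S'
  have heq : Nat.card (M ⧸ S) = Nat.card (M ⧸ S') := le_antisymm hc (MuZeroRank.card_quotient_le_of_le h)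
  have hpos : 0 < Nat.card (M ⧸ S') := Nat.card_pos
  have hcard : Nat.card S' ≤ Nat.card S := by
    rw [heq] at h1
    exact le_of_eq (Nat.eq_of_mul_eq_mul_right hpos (h2.symm.trans h1))
  apply le_antisymm h
  have hinj : Function.Injective (Submodule.inclusion h) := Submodule.inclusion_injective h
  have hbij : Function.Bijective (Submodule.inclusion h) := by
    rw [Nat.bijective_iff_injective_and_card]
    exact ⟨hinj, le_antisymm (Nat.card_le_card_of_injective _ hinj) hcard⟩
  intro x hx
  obtain ⟨w, hw⟩ := hbij.2 ⟨x, hx⟩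
  have : (w : M) = x := congrArg Subtype.val hw
  rw [← this]; exact w.2

/-- `ν₁M ⊆ pM + (φ−1)M` (`ν₁ = ∑_{i<p} φ^i ≡ T^{p−1} mod p`). [cite: Washington1997, §13.3 Prop. 13.23 (proof)] -/
theorem map_top_geom_sum_le [hp : Fact p.Prime] (φ : Module.End ℤ M) :
    (⊤ : Submodule ℤ M).map (∑ i ∈ range p, φ ^ i) ≤
      (⊤ : Submodule ℤ M).map ((p : ℤ) • (1 : Module.End ℤ M)) ⊔ (⊤ : Submodule ℤ M).map (φ - 1) := by
  -- `range T^{p-1} ≤ range T` as `p - 1 ≥ 1`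
  have hle : LinearMap.range ((φ - 1) ^ (p - 1)) ≤ (⊤ : Submodule ℤ M).map (φ - 1) := by
    obtain ⟨q, hq⟩ : ∃ q, p - 1 = q + 1 := ⟨p - 2, by have := hp.out.two_le; omega⟩
    rw [hq, pow_succ', Module.End.mul_eq_comp, Submodule.map_top]
    exact LinearMap.range_comp_le_range _ _
  rintro _ ⟨x, -, rfl⟩
  have h := MuZeroRank.geom_sum_apply_mem p 1 φ x
  rw [pow_one] at h
  obtain ⟨u, hu, v, hv, huv⟩ := Submodule.mem_sup.mp h
  rw [← huv, add_comm]
  refine Submodule.add_mem_sup ?_ (hle hu)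
  rwa [Submodule.map_top]

/-- **THE CYCLIC GENERATOR.**  `M` a finite abelian `p`-group, `φ^{p^t} = 1`: if `#M/ν₁M ≤ p` (`ν₁ = ∑_{i<p} φ^i`) then `M = ℤ[φ]·x₀` for some `x₀`
with `p·x₀ ∈ ν₁M` (Nakayama: `ν₁M ⊆ 𝔪M = pM + (φ−1)M` has index `≤ p`, so `M/𝔪M` is cyclic of order `≤ p` and `ν₁M = 𝔪M` unless `M = 0`).
[cite: Washington1997, §13.2 Lemma 13.16, §13.3 Lemma 13.15] [cite: Fukuda1994, Thm. 1 (proof, p. 264)] -/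
theorem exists_generator [Finite M] [hp : Fact p.Prime] (hM : ∃ a : ℕ, Nat.card M = p ^ a) (φ : Module.End ℤ M) {t : ℕ}
    (hφ : φ ^ p ^ t = 1) (h1 : Nat.card (M ⧸ (⊤ : Submodule ℤ M).map (∑ i ∈ range p, φ ^ i)) ≤ p) :
    ∃ x₀ : M, (∀ y : M, ∃ f : ℤ[X], aeval φ f x₀ = y) ∧
      (p : ℤ) • x₀ ∈ (⊤ : Submodule ℤ M).map (∑ i ∈ range p, φ ^ i) := by
  classical
  obtain ⟨a, ha⟩ := hM
  set π : Module.End ℤ M := (p : ℤ) • 1 with hπ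
  set T : Module.End ℤ M := φ - 1 with hT
  set Q : Submodule ℤ M := (⊤ : Submodule ℤ M).map π ⊔ (⊤ : Submodule ℤ M).map T with hQ
  set V : Submodule ℤ M := (⊤ : Submodule ℤ M).map (∑ i ∈ range p, φ ^ i) with hV
  have hVQ : V ≤ Q := map_top_geom_sum_le φ
  have hQle : Nat.card (M ⧸ Q) ≤ p := (MuZeroRank.card_quotient_le_of_le hVQ).trans h1
  -- the evaluation map at a point and its range `ℤ[φ]·x`
  have hrange : ∀ x : M, ∃ R₀ : Submodule ℤ M, (∀ y, y ∈ R₀ ↔ ∃ f : ℤ[X], aeval φ f x = y) ∧ (∀ y ∈ R₀, φ y ∈ R₀) := by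
    intro x
    let ev : ℤ[X] →ₗ[ℤ] M := (LinearMap.applyₗ x).comp (aeval φ : ℤ[X] →ₐ[ℤ] Module.End ℤ M).toLinearMap
    have hev : ∀ f, ev f = aeval φ f x := fun f => rfl
    refine ⟨LinearMap.range ev, fun y => ?_, ?_⟩
    · rw [LinearMap.mem_range]
      exact ⟨fun ⟨f, hf⟩ => ⟨f, by rw [← hev]; exact hf⟩, fun ⟨f, hf⟩ => ⟨f, by rw [hev]; exact hf⟩⟩
    · rintro _ ⟨f, rfl⟩
      refine ⟨X * f, ?_⟩
      rw [hev, hev, map_mul, aeval_X, Module.End.mul_apply]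
  by_cases hQtop : Q = ⊤
  · -- `M = 𝔪M`, so `M = 0`
    have hM0 : (⊤ : Submodule ℤ M) ≤ ⊥ :=
      le_of_le_sup_smul_sup_sub_one ⟨a, ha⟩ φ hφ (N := ⊤) (S := ⊥) (fun _ _ => Submodule.mem_top)
        (fun x hx => by rw [(Submodule.mem_bot ℤ).mp hx, map_zero]; exact Submodule.zero_mem _)
        (by rw [bot_sup_eq, ← hQ, hQtop])
    refine ⟨0, fun y => ⟨0, ?_⟩, by rw [smul_zero]; exact Submodule.zero_mem _⟩
    have hy : y = 0 := (Submodule.mem_bot ℤ).mp (hM0 (Submodule.mem_top (x := y)))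
    subst hy; simp
  · -- `#(M/Q) = p` and any `x₀ ∉ Q` generates `M/Q`
    obtain ⟨x₀, hx₀⟩ : ∃ x₀ : M, x₀ ∉ Q := by
      by_contra hall
      push Not at hall
      exact hQtop (eq_top_iff.mpr fun x _ => hall x)
    haveI : Finite (M ⧸ Q) := Finite.of_surjective _ (Submodule.Quotient.mk_surjective _)
    have hcardQ : Nat.card (M ⧸ Q) = p := by
      have hdvd : Nat.card (M ⧸ Q) ∣ p ^ a := by
        rw [← ha, Submodule.card_eq_card_quotient_mul_card Q]; exact Dvd.intro_left _ rfl
      obtain ⟨b, hb, hbeq⟩ := (Nat.dvd_prime_pow hp.out).mp hdvd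
      rcases b with _ | b
      · exfalso
        rw [pow_zero] at hbeq
        have hsub : Subsingleton (M ⧸ Q) := (Nat.card_eq_one_iff_unique.mp hbeq).1
        exact hx₀ ((Submodule.Quotient.mk_eq_zero Q).mp (Subsingleton.elim _ _))
      · rw [hbeq] at hQle ⊢
        have hb0 : b = 0 := by
          by_contra hb0
          have : p ^ 2 ≤ p ^ (b + 1) := Nat.pow_le_pow_right hp.out.pos (by omega)
          have hp2 : p < p ^ 2 := by
            calc p = p ^ 1 := (pow_one p).symm
              _ < p ^ 2 := Nat.pow_lt_pow_right hp.out.one_lt (by norm_num)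
          omega
        rw [hb0, zero_add, pow_one]
    have hgenQ : ∀ y : M, ∃ n : ℤ, y - n • x₀ ∈ Q := by
      intro y
      have hxbar : Q.mkQ x₀ ≠ 0 := fun h => hx₀ ((Submodule.Quotient.mk_eq_zero Q).mp h)
      have hord : addOrderOf (Q.mkQ x₀) = p := by
        have hdvd : addOrderOf (Q.mkQ x₀) ∣ p := by
          rw [← hcardQ]; exact addOrderOf_dvd_natCard _
        rcases (Nat.dvd_prime hp.out).mp hdvd with h | h
        · exact absurd (AddMonoid.addOrderOf_eq_one_iff.mp h) hxbar
        · exact h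
      have htop : AddSubgroup.zmultiples (Q.mkQ x₀) = ⊤ := by
        apply AddSubgroup.eq_top_of_card_eq
        rw [Nat.card_zmultiples, hord, hcardQ]
      have hy : Q.mkQ y ∈ AddSubgroup.zmultiples (Q.mkQ x₀) := by
        rw [htop]; exact AddSubgroup.mem_top _
      obtain ⟨n, hn⟩ := AddSubgroup.mem_zmultiples_iff.mp hy
      refine ⟨n, ?_⟩
      rw [← Submodule.ker_mkQ Q, LinearMap.mem_ker, map_sub, map_zsmul, ← hn, sub_self]
    obtain ⟨R₀, hR₀, hR₀φ⟩ := hrange x₀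
    have htop : (⊤ : Submodule ℤ M) ≤ R₀ ⊔ ((⊤ : Submodule ℤ M).map π ⊔ (⊤ : Submodule ℤ M).map T) := by
      intro y _
      obtain ⟨n, hn⟩ := hgenQ y
      have hy : y = n • x₀ + (y - n • x₀) := by abel
      rw [hy]
      refine Submodule.add_mem_sup ((hR₀ _).mpr ⟨C n, ?_⟩) hn
      rw [aeval_C, algebraMap_int_eq, eq_intCast, Module.End.intCast_apply]
    have hMR₀ : (⊤ : Submodule ℤ M) ≤ R₀ :=
      le_of_le_sup_smul_sup_sub_one ⟨a, ha⟩ φ hφ (fun _ _ => Submodule.mem_top) hR₀φ htop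
    refine ⟨x₀, fun y => (hR₀ y).mp (hMR₀ Submodule.mem_top), ?_⟩
    -- `ν₁M = 𝔪M ∋ p x₀`
    have hVQ' : V = Q := by
      refine eq_of_le_of_card_quotient_le hVQ ?_
      rw [hcardQ]; exact h1
    rw [hVQ']
    exact Submodule.mem_sup_left ⟨x₀, Submodule.mem_top, rfl⟩

/-! ## §4 The filtration count `#(M/(T^mM + P)) ≤ (#(M/(TM + P)))^m` (re-proved: private in `ClassicalMuVanishesBoundedRankAlgebra`) -/

section Filtration

variable (T : Module.End ℤ M) (P : Submodule ℤ M)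

/-- `T^{k+1}M + P ≤ T^kM + P`. [folklore] -/
private theorem range_pow_succ_sup_le (k : ℕ) :
    LinearMap.range (T ^ (k + 1)) ⊔ P ≤ LinearMap.range (T ^ k) ⊔ P := by
  refine sup_le_sup_right ?_ _
  rw [pow_succ, Module.End.mul_eq_comp]
  exact LinearMap.range_comp_le_range _ _

/-- `#(M/Y) = #(M/X) · #(X/Y)` for `Y ≤ X`. [folklore] -/
private theorem card_quotient_eq_mul {X Y : Submodule ℤ M} (h : Y ≤ X) :
    Nat.card (M ⧸ Y) = Nat.card (M ⧸ X) * Nat.card (X.map Y.mkQ) := by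
  rw [Submodule.card_eq_card_quotient_mul_card (X.map Y.mkQ), mul_comm,
    Nat.card_congr (Submodule.quotientQuotientEquivQuotient Y X h).toEquiv]

/-- The graded piece `(T^kM + P)/(T^{k+1}M + P)` is a quotient of `M/(TM + P)` (`v ↦ [T^k v]` kills `TM + P` when `P` is `T`-stable).
[cite: Washington1997, §13.3 Prop. 13.23 (proof)] -/
private theorem card_map_mkQ_le [Finite M] (hP : ∀ w ∈ P, T w ∈ P) (k : ℕ) :
    Nat.card ((LinearMap.range (T ^ k) ⊔ P).map (LinearMap.range (T ^ (k + 1)) ⊔ P).mkQ) ≤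
      Nat.card (M ⧸ (LinearMap.range T ⊔ P)) := by
  set W1 : Submodule ℤ M := LinearMap.range (T ^ (k + 1)) ⊔ P with hW1
  set f := W1.mkQ ∘ₗ (T ^ k) with hf
  have hPk : ∀ i : ℕ, ∀ w ∈ P, (T ^ i) w ∈ P := by
    intro i; induction i with
    | zero => intro w hw; simpa using hw
    | succ i ih => intro w hw; rw [pow_succ', Module.End.mul_apply]; exact hP _ (ih w hw)
  have hPW1 : P ≤ LinearMap.ker W1.mkQ := by rw [Submodule.ker_mkQ]; exact le_sup_right
  have hrange : (LinearMap.range (T ^ k) ⊔ P).map W1.mkQ = LinearMap.range f := by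
    rw [Submodule.map_sup, LinearMap.le_ker_iff_map.mp hPW1, sup_bot_eq, hf, LinearMap.range_comp]
  have hker : LinearMap.range T ⊔ P ≤ LinearMap.ker f := by
    refine sup_le ?_ ?_
    · rintro _ ⟨a, rfl⟩
      rw [LinearMap.mem_ker, hf, LinearMap.comp_apply]
      refine (Submodule.Quotient.mk_eq_zero W1).mpr (Submodule.mem_sup_left ⟨a, ?_⟩)
      rw [pow_succ, Module.End.mul_apply]
    · intro b hb
      rw [LinearMap.mem_ker, hf, LinearMap.comp_apply]
      exact (Submodule.Quotient.mk_eq_zero W1).mpr (Submodule.mem_sup_right (hPk k b hb))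
  haveI : Finite (M ⧸ LinearMap.ker f) := Finite.of_surjective _ (Submodule.Quotient.mk_surjective _)
  haveI : Finite (M ⧸ (LinearMap.range T ⊔ P)) := Finite.of_surjective _ (Submodule.Quotient.mk_surjective _)
  rw [hrange, ← Nat.card_congr (LinearMap.quotKerEquivRange f).toEquiv]
  exact Nat.card_le_card_of_surjective _ (Submodule.factor_surjective hker)

/-- **`#(M/(T^mM + P)) ≤ #(M/(TM + P))^m`** for a `T`-stable `P`. [cite: Washington1997, §13.3 Prop. 13.23 (proof)] -/
theorem card_quotient_range_pow_sup_le_pow [Finite M] (hP : ∀ w ∈ P, T w ∈ P) (m : ℕ) :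
    Nat.card (M ⧸ (LinearMap.range (T ^ m) ⊔ P)) ≤ Nat.card (M ⧸ (LinearMap.range T ⊔ P)) ^ m := by
  induction m with
  | zero =>
    rw [pow_zero, pow_zero, Module.End.one_eq_id, LinearMap.range_id, top_sup_eq, Nat.card_unique]
  | succ m ih =>
    calc _ = _ := card_quotient_eq_mul (range_pow_succ_sup_le T P m)
      _ ≤ Nat.card (M ⧸ (LinearMap.range (T ^ m) ⊔ P)) * Nat.card (M ⧸ (LinearMap.range T ⊔ P)) :=
          Nat.mul_le_mul_left _ (card_map_mkQ_le T P hP m)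
      _ ≤ _ := by rw [pow_succ]; exact Nat.mul_le_mul_right _ ih

end Filtration

end Module

end Literature.NumberTheory.IwasawaTheory.FukudaElementary

end
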